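import Mathlib
import Literature.NumberTheory.LFunctions.Zhang2022.Section6ZfacBound
import Literature.NumberTheory.LFunctions.Zhang2022.Section2ZfacCrudeBound
import HarnessLib

/-!
# Zhang (2022), §6, proof of Lemma 6.1: the outer segments `u = −1, |v| > 𝓛²⁰` of (6.2)
# contribute `≪ ε` (prose node p. 32, tex L1746), kernel-checked

Topic `Literature/NumberTheory/LFunctions/Zhang2022` (Landau–Siegel audit tree; verdict-neutral).
Y. Zhang, *Discrete mean estimates and the Landau–Siegel zero*, arXiv:2211.02515v1 (2022)
[Zhang2022LandauSiegel] — **an unrefereed manuscript under adjudication; nothing here asserts or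
denies its Theorems 1–2.** Campaign D-0069 (discharge lane, layer L2): companion of
`Section6TailBounds.lean` / `Section6ZfacBound.lean`; THEOREM-ONLY.

§6 p. 32 (tex L1746), inside the proof of (6.2):

> By a trivial bound for `ω₁(w)` and simple estimates, the integrals on the segments `u = −1`,
> `|v| > 𝓛²⁰` contribute `≪ ε`.

The typed claim is `Section6Statements.Step6outer` (both half-lines `v > 𝓛²⁰`, `v < −𝓛²⁰` of the
(6.2)-integrand `Z(s+w,ψ)(Σ_{n≥T³}ψ̄(n)n^{−(1−s−w)})P₄^wω₁(w)/w` at `w = −1 + iv`, bound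
`C·exp(−c𝓛¹⁰)`; with the blanket Assumption (A) binder, unused here).

| decl | DAG node | status |
|---|---|---|
| `one_add_abs_im_le`, `norm_kern_outer_le`, `cube_mul_exp_le` (private) | — | `1+|t+v| ≤ 11𝓛⁵¹⁹|v|`; `‖P₄^wω₁(w)/w‖ ≤ P₄⁻¹e·e^{−|v|/(4𝓛¹⁰)}`; `|v|³e^{−|v|/(4L)} ≤ 3072L³e^{−|v|/(8L)}` |
| `norm_integrand62_outer_le` | — | the pointwise majorant `C₀PT²𝓛¹⁵⁸⁷e^{−|v|/(8𝓛¹⁰)}` of the (6.2)-integrand at `w = −1+iv`, `|v| ≥ 𝓛²⁰` (`Z` by `GammaFactor.norm_Zfac_le_crude`, tail `≤ 5` by `Section6TailBounds.norm_tailSum_le`) |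
| `step6outer_holds` | `Lem6.1.pf` prose (tex L1746) | **DISCHARGED**: `Section6Statements.Step6outer` holds with `c = 1/16`, for `D ≥ ⌈e⁶⁴⌉` |

Route ("trivial bound for `ω₁(w)` and simple estimates", made explicit): at `w = −1 + iv`,
`|ω₁(w)| = exp((1−v²)/(4𝓛³⁰)) ≤ e·exp(−|v|𝓛⁻¹⁰/4)` for `|v| ≥ 𝓛²⁰`; `|P₄^w| = P₄⁻¹ = T²/(Pt₀)`;
`|1/w| ≤ 1`; the tail is `≤ 5` (`Section6TailBounds.norm_tailSum_le`, `Re(1−s−w) = 2−σ ≥ 5/4`);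
`|Z(s+w,ψ)| ≤ 120π²p²(1+|t+v|)³` (`Section2ZfacCrudeBound`, any sign of `t+v`); `(1+|t|+|v|)³ ≤ 11³𝓛¹⁵⁵⁷|v|³` and
`|v|³e^{−|v|𝓛⁻¹⁰/4} ≤ 3072𝓛³⁰e^{−|v|𝓛⁻¹⁰/8}`; integrating `e^{−|v|/(8𝓛¹⁰)}` over `|v| > 𝓛²⁰` gives
`8𝓛¹⁰e^{−𝓛¹⁰/8}` per side, and `PT²𝓛¹⁵⁹⁷e^{−𝓛¹⁰/8} ≤ e^{−𝓛¹⁰/16}` once `𝓛 ≥ 64`. No fact beyond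
Mathlib and the tree's Γ-bounds (FACT-LIST F-09) is used.

## References

* Y. Zhang, arXiv:2211.02515v1 (2022), §6 p. 32, proof of Lemma 6.1, (6.2); §2 (2.2), §4 p. 18
  (`ω₁`). [cite: Zhang2022LandauSiegel, §6 (6.2) p.32]
-/

noncomputable section

open Complex Real MeasureTheory Set Filter

namespace Literature.NumberTheory.LFunctions.Zhang2022.Section6TailBounds

open Skeleton Section6Statements
/-! ## The pointwise majorant on `u = −1`, `|v| ≥ 𝓛²⁰` -/

/-- `y³ ≤ 6e^{y}` for `y ≥ 0` (`y³/3! ≤ e^y`). [folklore] -/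
private theorem cube_le_six_exp {y : ℝ} (hy : 0 ≤ y) : y ^ 3 ≤ 6 * Real.exp y := by
  have h := Real.pow_div_factorial_le_exp y hy 3
  have h3 : (Nat.factorial 3 : ℝ) = 6 := by norm_num [Nat.factorial]
  rw [h3, div_le_iff₀ (by norm_num)] at h
  linarith

/-- `|v|³e^{−|v|/(4L)} ≤ 3072L³e^{−|v|/(8L)}` for `L > 0` (with `y = |v|/(8L)`: `|v|³ = 512L³y³ ≤ 3072L³e^y`).
[folklore] -/
private theorem cube_mul_exp_le {L a : ℝ} (hL : 0 < L) (ha : 0 ≤ a) :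
    a ^ 3 * Real.exp (-a / (4 * L)) ≤ 3072 * L ^ 3 * Real.exp (-a / (8 * L)) := by
  set y : ℝ := a / (8 * L) with hy
  have hy0 : 0 ≤ y := by positivity
  have ha' : a = 8 * L * y := by rw [hy]; field_simp
  have h1 : a ^ 3 = 512 * L ^ 3 * y ^ 3 := by rw [ha']; ring
  have h2 : Real.exp (-a / (4 * L)) = Real.exp (-y) * Real.exp (-y) := by
    rw [← Real.exp_add]; congr 1; rw [ha']; field_simp; ring
  have h3 : Real.exp (-a / (8 * L)) = Real.exp (-y) := by
    congr 1; rw [ha']; field_simp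
  rw [h1, h2, h3]
  have hc := cube_le_six_exp hy0
  have hE : 0 < Real.exp (-y) := Real.exp_pos _
  have hEE : Real.exp y * Real.exp (-y) = 1 := by rw [← Real.exp_add, add_neg_cancel, Real.exp_zero]
  have hL3 : 0 ≤ L ^ 3 := by positivity
  calc 512 * L ^ 3 * y ^ 3 * (Real.exp (-y) * Real.exp (-y))
      ≤ 512 * L ^ 3 * (6 * Real.exp y) * (Real.exp (-y) * Real.exp (-y)) := by gcongr
    _ = 3072 * L ^ 3 * (Real.exp y * Real.exp (-y)) * Real.exp (-y) := by ring
    _ = 3072 * L ^ 3 * Real.exp (-y) := by rw [hEE, mul_one]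

/-- The height factor on the outer segments: `1 + |t + v| ≤ 11𝓛⁵¹⁹|v|` for `s` in the range of
Lemma 6.1 and `|v| ≥ 1` (`|t| ≤ 2πt₀ + 𝓛₁ + 2 ≤ 10𝓛⁵¹⁹ − 1`, `D ≥ 9`). [cite: Zhang2022LandauSiegel, §6 p.32] -/
private theorem one_add_abs_im_le {D : ℕ} (hD : 9 ≤ D) {s : ℂ} (hs : InRange61 D s) {v : ℝ}
    (hv1 : 1 ≤ |v|) : 1 + |s.im + v| ≤ 11 * ell D ^ 519 * |v| := by
  obtain ⟨_, ht⟩ := hs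
  rw [t0, ell1] at ht
  obtain ⟨ht1, ht2⟩ := abs_lt.mp ht
  have hℓ := two_le_ell hD
  have hav : |s.im + v| ≤ |s.im| + |v| := abs_add_le _ _
  have h519 : (0 : ℝ) ≤ ell D ^ 519 := by positivity
  have h519pos : 0 ≤ 2 * π * ell D ^ 519 := by positivity
  have hsi : |s.im| ≤ 2 * π * ell D ^ 519 + ell D ^ 405 + 2 := by
    rw [abs_le]; constructor <;> linarith
  have h405 : ell D ^ 405 ≤ ell D ^ 519 := ell_pow_le_pow hD (by norm_num)
  have h4 : (4 : ℝ) ≤ ell D ^ 519 := by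
    have h2sq : (2 : ℝ) ^ 2 ≤ ell D ^ 2 := pow_le_pow_left₀ (by norm_num) hℓ 2
    have h2' : ell D ^ 2 ≤ ell D ^ 519 := ell_pow_le_pow hD (by norm_num)
    linarith
  have h2π : 2 * π * ell D ^ 519 ≤ 8 * ell D ^ 519 :=
    mul_le_mul_of_nonneg_right (by linarith [Real.pi_lt_four]) h519
  have hsi' : 1 + |s.im| ≤ 10 * ell D ^ 519 := by linarith
  have hv0 : 0 ≤ |v| := abs_nonneg v
  have e1 : 10 * ell D ^ 519 * 1 ≤ 10 * ell D ^ 519 * |v| :=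
    mul_le_mul_of_nonneg_left hv1 (by positivity)
  have e2 : 1 * |v| ≤ ell D ^ 519 * |v| := mul_le_mul_of_nonneg_right (by linarith) hv0
  linarith

/-- The Perron kernel on the outer segments: for `|v| ≥ 𝓛²⁰` (`D ≥ 9`), at `w = −1 + iv`,
`‖P₄^w ω₁(w)/w‖ ≤ P₄⁻¹·e·e^{−|v|/(4𝓛¹⁰)}` (`|ω₁(w)| = e^{(1−v²)/(4𝓛³⁰)}`, `v² ≥ 𝓛²⁰|v|`, `|w| ≥ 1`).
[cite: Zhang2022LandauSiegel, §6 (6.2) p.32] -/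
private theorem norm_kern_outer_le {D : ℕ} (hD : 9 ≤ D) {v : ℝ} (hv : ell D ^ 20 ≤ |v|) :
    ‖kern D (-1 + (v : ℂ) * I)‖ ≤
      (P4 D)⁻¹ * (Real.exp 1 * Real.exp (-|v| / (4 * ell D ^ 10))) := by
  have hℓ := two_le_ell hD
  have hℓ0 : 0 < ell D := by linarith
  have hP4 : 0 < P4 D := by
    rw [P4, bigP, bigT, t0]; positivity
  have hv0 : 0 ≤ |v| := abs_nonneg v
  set w : ℂ := -1 + (v : ℂ) * I with hw
  have hP4n : ‖((P4 D : ℝ) : ℂ) ^ w‖ = (P4 D)⁻¹ := by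
    rw [Complex.norm_cpow_eq_rpow_re_of_pos hP4]
    have : w.re = -1 := by simp [hw]
    rw [this, Real.rpow_neg_one]
  have hω : ‖GaussWeight.omega1 (ell D ^ 30) w‖ = Real.exp ((1 - v ^ 2) / (4 * ell D ^ 30)) := by
    have e : w = ((-1 : ℝ) : ℂ) + (v : ℂ) * I := by rw [hw]; push_cast; ring
    rw [e, GaussWeight.norm_omega1]; norm_num
  have hwn : 1 ≤ ‖w‖ := by
    calc (1 : ℝ) = |w.re| := by simp [hw]
      _ ≤ ‖w‖ := Complex.abs_re_le_norm w
  have hωle : Real.exp ((1 - v ^ 2) / (4 * ell D ^ 30)) ≤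
      Real.exp 1 * Real.exp (-|v| / (4 * ell D ^ 10)) := by
    rw [← Real.exp_add]
    apply Real.exp_le_exp.mpr
    have h30 : (1 : ℝ) ≤ ell D ^ 30 := one_le_pow₀ (by linarith)
    have hvsq : ell D ^ 20 * |v| ≤ v ^ 2 := by
      calc ell D ^ 20 * |v| ≤ |v| * |v| := mul_le_mul_of_nonneg_right hv hv0
        _ = v ^ 2 := by rw [← sq, sq_abs]
    rw [div_le_iff₀ (by positivity)]
    have hℓ10 : (4 : ℝ) * ell D ^ 10 ≠ 0 := by positivity
    have e10 : -|v| / (4 * ell D ^ 10) * (4 * ell D ^ 30) = -(ell D ^ 20 * |v|) := by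
      rw [show (4 : ℝ) * ell D ^ 30 = (4 * ell D ^ 10) * ell D ^ 20 by ring, ← mul_assoc,
        div_mul_cancel₀ _ hℓ10]
      ring
    rw [add_mul, e10]
    linarith
  rw [kern, norm_div, norm_mul, hP4n, hω]
  calc (P4 D)⁻¹ * Real.exp ((1 - v ^ 2) / (4 * ell D ^ 30)) / ‖w‖
      ≤ (P4 D)⁻¹ * Real.exp ((1 - v ^ 2) / (4 * ell D ^ 30)) / 1 :=
        div_le_div_of_nonneg_left (by positivity) one_pos hwn
    _ = (P4 D)⁻¹ * Real.exp ((1 - v ^ 2) / (4 * ell D ^ 30)) := div_one _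
    _ ≤ (P4 D)⁻¹ * (Real.exp 1 * Real.exp (-|v| / (4 * ell D ^ 10))) :=
        mul_le_mul_of_nonneg_left hωle (by positivity)

/-- **The (6.2)-integrand on the outer segments** (§6 p. 32, "a trivial bound for `ω₁(w)` and simple
estimates", made explicit): for `D ≥ 9`, `ψ (mod p) ∈ Ψ`, `s` in the range of Lemma 6.1 and
`|v| ≥ 𝓛²⁰`, at `w = −1 + iv`:
`‖Z(s+w,ψ)(Σ_{n≥T³}ψ̄(n)n^{−(1−s−w)})P₄^wω₁(w)/w‖ ≤ C₀·P·T²·𝓛¹⁵⁸⁷·e^{−|v|/(8𝓛¹⁰)}` with the absolute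
`C₀ = 120π²·1331·5·e·3072·(81/64)`. [cite: Zhang2022LandauSiegel, §6 (6.2) p.32] -/
theorem norm_integrand62_outer_le {D : ℕ} (hD : 9 ≤ D) (x : Chr D) {s : ℂ} (hs : InRange61 D s)
    {v : ℝ} (hv : ell D ^ 20 ≤ |v|) :
    ‖integrand62 x s (-1 + v * I)‖ ≤
      (120 * π ^ 2 * 1331 * 5 * Real.exp 1 * 3072 * (81 / 64)) * bigP D * bigT D ^ 2 *
        ell D ^ 1587 * Real.exp (-|v| / (8 * ell D ^ 10)) := by
  have hπ := Real.pi_pos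
  have hℓ := two_le_ell hD
  have hℓ0 : 0 < ell D := by linarith
  have hα := alpha_le hD
  have hP : 0 < bigP D := Real.exp_pos _
  have hT : 0 < bigT D := Real.exp_pos _
  have ht0 : 1 ≤ t0 D := by
    rw [t0]; exact le_trans (by norm_num) (two_le_ell_pow hD (n := 519) (by norm_num))
  have hP4 : 0 < P4 D := by rw [P4]; positivity
  obtain ⟨hp1, hp2⟩ := p_range hD x
  have hp0 : (0 : ℝ) < x.p := hP.trans hp1
  have h20 : (1 : ℝ) ≤ ell D ^ 20 := one_le_pow₀ (by linarith)
  have hv1 : 1 ≤ |v| := h20.trans hv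
  have hv0 : 0 ≤ |v| := abs_nonneg v
  have hpoly1 := one_add_abs_im_le hD hs hv1
  have hkern := norm_kern_outer_le hD hv
  obtain ⟨hσ, -⟩ := hs
  obtain ⟨hσ1, hσ2⟩ := abs_lt.mp hσ
  set w : ℂ := -1 + (v : ℂ) * I with hw
  -- (Z): the crude bound at `s + w`, `Re = σ − 1 ∈ [−3/4, −1/4]`
  have hre : (s + w).re = s.re - 1 := by simp [hw]; ring
  have him : (s + w).im = s.im + v := by simp [hw]
  haveI : NeZero x.p := ⟨x.prime.ne_zero⟩
  have hZ := GammaFactor.norm_Zfac_le_crude x.prim (s := s + w) (by rw [hre]; linarith) (by rw [hre]; linarith)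
  rw [him] at hZ
  -- (tail): `≤ 5`
  have hT1 : 1 ≤ bigT D ^ 3 :=
    one_le_pow₀ (Real.one_le_exp (Real.rpow_nonneg (Real.log_natCast_nonneg D) _))
  have hare : (1 - s - w).re = 2 - s.re := by simp [hw]; ring
  have htail0 := norm_tailSum_le x s w (by rw [hare]; linarith) hT1
  rw [hare] at htail0
  have htail : ‖tailSum x s w‖ ≤ 5 := by
    have h1 : (bigT D ^ 3) ^ (1 - (2 - s.re)) ≤ 1 :=
      Real.rpow_le_one_of_one_le_of_nonpos hT1 (by linarith)
    linarith [mul_le_mul_of_nonneg_left h1 (by norm_num : (0 : ℝ) ≤ 5)]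
  -- (poly): `(1 + |t + v|)³ ≤ 1331 𝓛¹⁵⁵⁷ |v|³`
  have hpoly : (1 + |s.im + v|) ^ 3 ≤ 1331 * ell D ^ 1557 * |v| ^ 3 := by
    have h0 : 0 ≤ 1 + |s.im + v| := by positivity
    calc (1 + |s.im + v|) ^ 3 ≤ (11 * ell D ^ 519 * |v|) ^ 3 := pow_le_pow_left₀ h0 hpoly1 3
      _ = 1331 * ell D ^ 1557 * |v| ^ 3 := by ring
  -- (cube·exp)
  have hce := cube_mul_exp_le (L := ell D ^ 10) (a := |v|) (by positivity) hv0
  -- assemble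
  have hp2sq : (x.p : ℝ) ^ 2 ≤ (81 / 64) * bigP D ^ 2 := by
    calc (x.p : ℝ) ^ 2 ≤ (9 / 8 * bigP D) ^ 2 := pow_le_pow_left₀ hp0.le hp2 2
      _ = (81 / 64) * bigP D ^ 2 := by ring
  have hP4inv : (P4 D)⁻¹ ≤ bigT D ^ 2 / bigP D := by
    have e : (P4 D)⁻¹ = bigT D ^ 2 / (bigP D * t0 D) := by
      rw [P4]; field_simp
    rw [e]
    exact div_le_div_of_nonneg_left (by positivity) hP (le_mul_of_one_le_right hP.le ht0)
  have hkern' : ‖kern D w‖ ≤ bigT D ^ 2 / bigP D * (Real.exp 1 * Real.exp (-|v| / (4 * ell D ^ 10))) :=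
    hkern.trans (mul_le_mul_of_nonneg_right hP4inv (by positivity))
  have hZ' : ‖GammaFactor.Zfac x.ψ (s + w)‖ ≤
      120 * π ^ 2 * ((81 / 64) * bigP D ^ 2) * (1331 * ell D ^ 1557 * |v| ^ 3) := by
    calc ‖GammaFactor.Zfac x.ψ (s + w)‖ ≤ 120 * π ^ 2 * (x.p : ℝ) ^ 2 * (1 + |s.im + v|) ^ 3 := hZ
      _ ≤ 120 * π ^ 2 * ((81 / 64) * bigP D ^ 2) * (1331 * ell D ^ 1557 * |v| ^ 3) := by
          gcongr
  -- collect the `v`-dependence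
  set E4 : ℝ := Real.exp (-|v| / (4 * ell D ^ 10)) with hE4
  set E8 : ℝ := Real.exp (-|v| / (8 * ell D ^ 10)) with hE8
  have hE4pos : 0 ≤ E4 := (Real.exp_pos _).le
  have hce' : |v| ^ 3 * E4 ≤ 3072 * (ell D ^ 10) ^ 3 * E8 := hce
  have hprod : ‖GammaFactor.Zfac x.ψ (s + w)‖ * ‖tailSum x s w‖ * ‖kern D w‖ ≤
      (120 * π ^ 2 * ((81 / 64) * bigP D ^ 2) * (1331 * ell D ^ 1557 * |v| ^ 3)) * 5 *
        (bigT D ^ 2 / bigP D * (Real.exp 1 * E4)) :=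
    mul_le_mul (mul_le_mul hZ' htail (norm_nonneg _) (by positivity)) hkern' (norm_nonneg _)
      (by positivity)
  have halg : (120 * π ^ 2 * ((81 / 64) * bigP D ^ 2) * (1331 * ell D ^ 1557 * |v| ^ 3)) * 5 *
        (bigT D ^ 2 / bigP D * (Real.exp 1 * E4)) =
      (120 * π ^ 2 * 1331 * 5 * Real.exp 1 * (81 / 64)) * bigP D * bigT D ^ 2 * ell D ^ 1557 *
        (|v| ^ 3 * E4) := by
    field_simp
  have hK0 : 0 ≤ (120 * π ^ 2 * 1331 * 5 * Real.exp 1 * (81 / 64)) * bigP D * bigT D ^ 2 *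
      ell D ^ 1557 := by positivity
  rw [integrand62, norm_mul, norm_mul]
  calc ‖GammaFactor.Zfac x.ψ (s + w)‖ * ‖tailSum x s w‖ * ‖kern D w‖
      ≤ (120 * π ^ 2 * 1331 * 5 * Real.exp 1 * (81 / 64)) * bigP D * bigT D ^ 2 * ell D ^ 1557 *
          (|v| ^ 3 * E4) := by rw [← halg]; exact hprod
    _ ≤ (120 * π ^ 2 * 1331 * 5 * Real.exp 1 * (81 / 64)) * bigP D * bigT D ^ 2 * ell D ^ 1557 *
          (3072 * (ell D ^ 10) ^ 3 * E8) := mul_le_mul_of_nonneg_left hce' hK0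
    _ = (120 * π ^ 2 * 1331 * 5 * Real.exp 1 * 3072 * (81 / 64)) * bigP D * bigT D ^ 2 *
          ell D ^ 1587 * E8 := by ring

/-! ## `Step6outer`: integrating the majorant over `|v| > 𝓛²⁰` -/

/-- The exponent bookkeeping of the outer segments: for `𝓛 ≥ 64`,
`P·T²·𝓛¹⁵⁸⁷·(8𝓛¹⁰e^{−𝓛¹⁰/8}) ≤ e^{−𝓛¹⁰/16}` (`P = e^{𝓛⁹}`, `T² = e^{2𝓛^{1.1}}`,
`8𝓛¹⁵⁹⁷ ≤ e^{7+1597𝓛}`, and `𝓛⁹ + 2𝓛^{1.1} + 1597𝓛 + 7 ≤ 4𝓛⁹ ≤ 𝓛¹⁰/16`).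
[cite: Zhang2022LandauSiegel, §6 (6.2) p.32] -/
private theorem prefactor_le {D : ℕ} (hℓ : 64 ≤ ell D) :
    bigP D * bigT D ^ 2 * ell D ^ 1587 * (8 * ell D ^ 10 * Real.exp (-(ell D ^ 10) / 8)) ≤
      Real.exp (-(1 / 16) * ell D ^ 10) := by
  have hℓ1 : (1 : ℝ) ≤ ell D := by linarith
  have hℓ0 : (0 : ℝ) < ell D := by linarith
  set L : ℝ := ell D ^ (1.1 : ℝ) with hL
  have hT2 : bigT D ^ 2 = Real.exp (2 * L) := by
    rw [bigT, ← Real.exp_nat_mul, Nat.cast_ofNat]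
  have hpoly_pos : 0 < 8 * ell D ^ 1597 := by positivity
  have hpoly : 8 * ell D ^ 1597 = Real.exp (Real.log (8 * ell D ^ 1597)) :=
    (Real.exp_log hpoly_pos).symm
  have hlog : Real.log (8 * ell D ^ 1597) ≤ 7 + 1597 * ell D := by
    rw [Real.log_mul (by norm_num) (by positivity), Real.log_pow]
    have h8 : Real.log 8 ≤ 7 := by
      have := Real.log_le_sub_one_of_pos (show (0 : ℝ) < 8 by norm_num); linarith
    have hl : Real.log (ell D) ≤ ell D := by
      have := Real.log_le_sub_one_of_pos hℓ0; linarith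
    push_cast
    nlinarith
  -- `L ≤ 𝓛²  ≤ 𝓛⁹`, `1600𝓛 ≤ 𝓛⁹`, `64𝓛⁹ ≤ 𝓛¹⁰`
  have hL9 : L ≤ ell D ^ 9 := by
    calc L ≤ ell D ^ ((2 : ℕ) : ℝ) := Real.rpow_le_rpow_of_exponent_le hℓ1 (by norm_num)
      _ = ell D ^ 2 := Real.rpow_natCast _ _
      _ ≤ ell D ^ 9 := pow_le_pow_right₀ hℓ1 (by norm_num)
  have h2 : (4096 : ℝ) ≤ ell D ^ 2 := by nlinarith
  have h8' : ell D ^ 2 ≤ ell D ^ 8 := pow_le_pow_right₀ hℓ1 (by norm_num)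
  have h9 : 1600 * ell D ≤ ell D ^ 9 := by
    have e : ell D ^ 9 = ell D ^ 8 * ell D := by ring
    rw [e]; nlinarith
  have h10 : 64 * ell D ^ 9 ≤ ell D ^ 10 := by
    have e : ell D ^ 10 = ell D * ell D ^ 9 := by ring
    have : 0 ≤ ell D ^ 9 := by positivity
    rw [e]; nlinarith
  have key : ell D ^ 9 + 2 * L + Real.log (8 * ell D ^ 1597) + -(ell D ^ 10) / 8 ≤
      -(1 / 16) * ell D ^ 10 := by nlinarith
  calc bigP D * bigT D ^ 2 * ell D ^ 1587 * (8 * ell D ^ 10 * Real.exp (-(ell D ^ 10) / 8))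
      = bigP D * bigT D ^ 2 * (8 * ell D ^ 1597) * Real.exp (-(ell D ^ 10) / 8) := by ring
    _ = Real.exp (ell D ^ 9 + 2 * L + Real.log (8 * ell D ^ 1597) + -(ell D ^ 10) / 8) := by
        rw [bigP, hT2, Real.exp_add, Real.exp_add, Real.exp_add, Real.exp_log hpoly_pos]
    _ ≤ Real.exp (-(1 / 16) * ell D ^ 10) := Real.exp_le_exp.mpr key

/-- **`Z22:Lem6.1.pf` prose node (tex L1746) DISCHARGED** (§6 p. 32): "By a trivial bound for `ω₁(w)`
and simple estimates, the integrals on the segments `u = −1`, `|v| > 𝓛²⁰` contribute `≪ ε`" — the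
typed claim `Section6Statements.Step6outer` HOLDS, with `c = 1/16` (`ε = e^{−𝓛¹⁰/16}`), an absolute
`C`, for all `D ≥ ⌈e⁶⁴⌉`: both half-line integrals of the (6.2)-integrand at `w = −1 + iv` are bounded
by integrating the majorant `C₀PT²𝓛¹⁵⁸⁷e^{−|v|/(8𝓛¹⁰)}` of `norm_integrand62_outer_le` over
`|v| > 𝓛²⁰` (`= C₀PT²𝓛¹⁵⁸⁷·8𝓛¹⁰e^{−𝓛¹⁰/8}` per side) and `prefactor_le`. The Assumption (A) binder
is not used. [cite: Zhang2022LandauSiegel, §6 (6.2) p.32] -/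
theorem step6outer_holds : Step6outer := by
  refine ⟨1 / 16, by norm_num, 120 * π ^ 2 * 1331 * 5 * Real.exp 1 * 3072 * (81 / 64),
    ⌈Real.exp 64⌉₊, fun D _ χ hD _ _ _ x s hs => ?_⟩
  -- `D ≥ e⁶⁴`: `𝓛 ≥ 64`, `D ≥ 9`
  have hexpD : Real.exp 64 ≤ (D : ℝ) := le_trans (Nat.le_ceil _) (by exact_mod_cast hD)
  have hDpos : (0 : ℝ) < D := lt_of_lt_of_le (Real.exp_pos _) hexpD
  have hℓ : 64 ≤ ell D := by
    rw [ell, Real.le_log_iff_exp_le hDpos]; exact hexpD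
  have hD9 : 9 ≤ D := by
    have h65 : (64 : ℝ) + 1 ≤ Real.exp 64 := Real.add_one_le_exp _
    have : ((9 : ℕ) : ℝ) ≤ (D : ℝ) := by push_cast; linarith
    exact_mod_cast this
  have hℓ0 : 0 < ell D := by linarith
  set K₀ : ℝ := 120 * π ^ 2 * 1331 * 5 * Real.exp 1 * 3072 * (81 / 64) with hK₀
  set K : ℝ := K₀ * bigP D * bigT D ^ 2 * ell D ^ 1587 with hK
  have hK₀0 : 0 ≤ K₀ := by rw [hK₀]; positivity
  have hK0 : 0 ≤ K := by
    rw [hK]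
    have : 0 ≤ bigP D := (Real.exp_pos _).le
    have : 0 ≤ bigT D := (Real.exp_pos _).le
    positivity
  set V : ℝ := ell D ^ 20 with hV
  have hV0 : 0 < V := by rw [hV]; positivity
  set γ : ℝ := (8 * ell D ^ 10)⁻¹ with hγ
  have hγ0 : 0 < γ := by rw [hγ]; positivity
  -- the pointwise majorant, in the two half-line forms
  have hpt : ∀ v : ℝ, V ≤ |v| →
      ‖integrand62 x s (-1 + v * I)‖ ≤ K * Real.exp (-|v| / (8 * ell D ^ 10)) := by
    intro v hv
    have h := norm_integrand62_outer_le hD9 x hs hv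
    calc ‖integrand62 x s (-1 + v * I)‖ ≤ _ := h
      _ = K * Real.exp (-|v| / (8 * ell D ^ 10)) := by rw [hK, hK₀]
  have hptR : ∀ v ∈ Ioi V, ‖integrand62 x s (-1 + v * I)‖ ≤ K * Real.exp (-γ * v) := by
    intro v hv
    have hv' : V ≤ |v| := by rw [abs_of_pos (hV0.trans hv)]; exact hv.le
    have e : -|v| / (8 * ell D ^ 10) = -γ * v := by
      rw [abs_of_pos (hV0.trans hv), hγ]; ring
    rw [← e]; exact hpt v hv'
  have hptL : ∀ v ∈ Iio (-V), ‖integrand62 x s (-1 + v * I)‖ ≤ K * Real.exp (γ * v) := by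
    intro v hv
    have hvneg : v < 0 := by have := mem_Iio.mp hv; linarith
    have hv' : V ≤ |v| := by rw [abs_of_neg hvneg]; have := mem_Iio.mp hv; linarith
    have e : -|v| / (8 * ell D ^ 10) = γ * v := by
      rw [abs_of_neg hvneg, hγ]; ring
    rw [← e]; exact hpt v hv'
  -- the value of the majorant integrals
  have hval : Real.exp (-γ * V) / γ = 8 * ell D ^ 10 * Real.exp (-(ell D ^ 10) / 8) := by
    have e : -γ * V = -(ell D ^ 10) / 8 := by
      rw [hγ, hV]; field_simp
    rw [e, hγ, div_inv_eq_mul]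
    ring
  have hfin : K * (8 * ell D ^ 10 * Real.exp (-(ell D ^ 10) / 8)) ≤
      K₀ * Real.exp (-(1 / 16) * ell D ^ 10) := by
    have h := prefactor_le hℓ
    calc K * (8 * ell D ^ 10 * Real.exp (-(ell D ^ 10) / 8))
        = K₀ * (bigP D * bigT D ^ 2 * ell D ^ 1587 *
            (8 * ell D ^ 10 * Real.exp (-(ell D ^ 10) / 8))) := by rw [hK]; ring
      _ ≤ K₀ * Real.exp (-(1 / 16) * ell D ^ 10) := mul_le_mul_of_nonneg_left h hK₀0
  constructor
  · -- `v > 𝓛²⁰`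
    have hgi : IntegrableOn (fun v : ℝ => K * Real.exp (-γ * v)) (Ioi V) :=
      (integrableOn_exp_mul_Ioi (by linarith : -γ < 0) V).const_mul K
    have hbound : ‖∫ v in Ioi V, integrand62 x s (-1 + v * I)‖ ≤
        ∫ v in Ioi V, K * Real.exp (-γ * v) :=
      norm_integral_le_of_norm_le hgi ((ae_restrict_iff' measurableSet_Ioi).mpr
        (ae_of_all _ hptR))
    have hint : ∫ v in Ioi V, K * Real.exp (-γ * v) = K * (Real.exp (-γ * V) / γ) := by
      rw [integral_const_mul, integral_exp_mul_Ioi (by linarith : -γ < 0) V]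
      congr 1
      field_simp
    calc ‖∫ v in Ioi V, integrand62 x s (-1 + v * I)‖
        ≤ K * (Real.exp (-γ * V) / γ) := hbound.trans_eq hint
      _ = K * (8 * ell D ^ 10 * Real.exp (-(ell D ^ 10) / 8)) := by rw [hval]
      _ ≤ K₀ * Real.exp (-(1 / 16) * ell D ^ 10) := hfin
  · -- `v < −𝓛²⁰`
    have hgi' : IntegrableOn (fun v : ℝ => K * Real.exp (γ * v)) (Iic (-V)) :=
      (integrableOn_exp_mul_Iic hγ0 (-V)).const_mul K
    have hgi : IntegrableOn (fun v : ℝ => K * Real.exp (γ * v)) (Iio (-V)) :=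
      hgi'.mono_set Iio_subset_Iic_self
    have hbound : ‖∫ v in Iio (-V), integrand62 x s (-1 + v * I)‖ ≤
        ∫ v in Iio (-V), K * Real.exp (γ * v) :=
      norm_integral_le_of_norm_le hgi ((ae_restrict_iff' measurableSet_Iio).mpr
        (ae_of_all _ hptL))
    have hmono : ∫ v in Iio (-V), K * Real.exp (γ * v) ≤ ∫ v in Iic (-V), K * Real.exp (γ * v) :=
      setIntegral_mono_set hgi' (ae_of_all _ fun v => by positivity)
        Iio_subset_Iic_self.eventuallyLE
    have hint : ∫ v in Iic (-V), K * Real.exp (γ * v) = K * (Real.exp (-γ * V) / γ) := by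
      rw [integral_const_mul, integral_exp_mul_Iic hγ0 (-V)]
      congr 2
      ring_nf
    calc ‖∫ v in Iio (-V), integrand62 x s (-1 + v * I)‖
        ≤ K * (Real.exp (-γ * V) / γ) := (hbound.trans hmono).trans_eq hint
      _ = K * (8 * ell D ^ 10 * Real.exp (-(ell D ^ 10) / 8)) := by rw [hval]
      _ ≤ K₀ * Real.exp (-(1 / 16) * ell D ^ 10) := hfin

end Literature.NumberTheory.LFunctions.Zhang2022.Section6TailBounds
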